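import Mathlib
import Summits.ABC.ABC.Theses.CongruentialReceptacle

/-!
# Sketch — crux-ideate stmt-ABC-14354 (TameLocalReceptacle), ideator k = 2, round 1

First lemmas of the two idea cards, stated over existing declarations.

* `TLRInfty` — the modulus-free form of the crux; `tlr_of_tlrInfty` (PROVED here) is the
  direction a prover uses (WLOG one table); `tlrInfty_of_tlr` (PROVED, compactness) is the
  direction a refuter uses; `tlr_iff_tlrInfty` packages both.
* card `apical-cancellation`: `ApexRecursion`, `memberSum_eq_zero_of_apical`,
  `exists_apexTable`, `tameSum_eq_zero_of_apical` — ALL PROVED (no sorry).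
* card `tame-cycle-duality`: `DiscrepancyInequality` and `tlrInfty_iff_discrepancy` (statement).
-/

open Finset Literature.NumberTheory.DiophantineGeometry

namespace Summit.ABC.ABC.Cruxes.TameLocalReceptacle.Sketch

/-- The tame sum `Σ_{p ∣ abc} t(p; D_p)` of a table over a triple — literally the sum in the crux. -/
noncomputable def tameSum (t : ℕ → ℕ → ℕ → ℕ → ℕ → ℕ → ℕ → ℤ) (a b c : ℕ) : ℤ :=
  ∑ p ∈ (a * b * c).primeFactors, t p (a.factorization p) (b.factorization p) (c.factorization p)
    (a / p ^ a.factorization p % p) (b / p ^ b.factorization p % p) (c / p ^ c.factorization p % p)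

/-- The two windows of the crux for a table `t` with constants `c₁, c₁', ε`. -/
def Windowed (c₁ c₁' ε : ℝ) (t : ℕ → ℕ → ℕ → ℕ → ℕ → ℕ → ℕ → ℤ) : Prop :=
  ∀ p i j k r s z : ℕ, p.Prime →
    c₁ * (2 * ((i + j + k : ℕ) : ℝ) - 6 - ε) * Real.log p ≤ (t p i j k r s z : ℝ) ∧
      |(t p i j k r s z : ℝ)| ≤ c₁' * (((i + j + k : ℕ) : ℝ) + 1) * Real.log p

/-- **TLR∞** — the modulus-free form: ONE windowed integer table whose tame sum is two-sidedly
bounded on every κ-balanced abc-triple.  Equivalent to the crux (`tlr_of_tlrInfty` below is the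
trivial direction; the converse is König compactness over `n → ∞` then `ℓ → ∞`). -/
def TLRInfty : Prop :=
  ∀ κ : ℝ, 0 < κ → ∀ ε : ℝ, 0 < ε → ∃ c₁ c₁' c₃ : ℝ, 0 < c₁ ∧
    ∃ t : ℕ → ℕ → ℕ → ℕ → ℕ → ℕ → ℕ → ℤ, Windowed c₁ c₁' ε t ∧
      ∀ a b c : ℕ, IsABCTriple a b c → κ * (c : ℝ) ≤ (a : ℝ) → κ * (c : ℝ) ≤ (b : ℝ) →
        |(tameSum t a b c : ℝ)| ≤ c₃

/-- The direction a prover needs: a single two-sidedly bounded table serves every modulus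
(take `B :=` the sum itself).  PROVED. -/
theorem tlr_of_tlrInfty :
    TLRInfty → Summit.ABC.ABC.Theses.CongruentialReceptacle.TameLocalReceptacle := by
  intro h κ hκ ε hε
  obtain ⟨c₁, c₁', c₃, hc₁, t, hw, hsum⟩ := h κ hκ ε hε
  refine ⟨c₁, c₁', c₃, hc₁, 0, ?_⟩
  intro ℓ n _hℓ _h5 _hm
  refine ⟨t, hw, ?_⟩
  intro a b c habc ha hb _hndvd
  exact ⟨tameSum t a b c, hsum a b c habc ha hb, Int.ModEq.refl _⟩

/-! ### The direction a refuter needs: `TameLocalReceptacle → TLRInfty` by compactness (PROVED)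
König/Tychonoff over the finitely many admissible integer values per argument; for a fixed triple the
congruence modulo `ℓⁿ > |Σ| + c₃` is an equality; the closed sets `Z N` (tables good up to height `N`) are
nested and nonempty in the compact box, so their intersection is nonempty. -/

/-! ### uncurried tables -/

abbrev Idx := ℕ × ℕ × ℕ × ℕ × ℕ × ℕ × ℕ

/-- the atom of a triple at `p` -/
def atom (a b c p : ℕ) : Idx :=
  (p, a.factorization p, b.factorization p, c.factorization p,
    a / p ^ a.factorization p % p, b / p ^ b.factorization p % p, c / p ^ c.factorization p % p)

def curry7 (T : Idx → ℤ) : ℕ → ℕ → ℕ → ℕ → ℕ → ℕ → ℕ → ℤ :=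
  fun p i j k r s z => T (p, i, j, k, r, s, z)

noncomputable def tameSumU (T : Idx → ℤ) (a b c : ℕ) : ℤ :=
  ∑ p ∈ (a * b * c).primeFactors, T (atom a b c p)

theorem tameSum_curry7 (T : Idx → ℤ) (a b c : ℕ) : tameSum (curry7 T) a b c = tameSumU T a b c := rfl

/-- lower / upper window of an index -/
noncomputable def loI (c₁ ε : ℝ) (α : Idx) : ℝ :=
  c₁ * (2 * ((α.2.1 + α.2.2.1 + α.2.2.2.1 : ℕ) : ℝ) - 6 - ε) * Real.log α.1
noncomputable def hiI (c₁' : ℝ) (α : Idx) : ℝ :=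
  c₁' * (((α.2.1 + α.2.2.1 + α.2.2.2.1 : ℕ) : ℝ) + 1) * Real.log α.1

/-- the compact box of admissible values -/
def boxSet (c₁ c₁' ε : ℝ) (α : Idx) : Set ℤ :=
  if α.1.Prime then {v : ℤ | loI c₁ ε α ≤ (v : ℝ) ∧ |(v : ℝ)| ≤ hiI c₁' α} else {0}

theorem boxSet_finite (c₁ c₁' ε : ℝ) (α : Idx) : (boxSet c₁ c₁' ε α).Finite := by
  unfold boxSet
  split_ifs with h
  · apply (Set.finite_Icc (-(⌈hiI c₁' α⌉ : ℤ)) ⌈hiI c₁' α⌉).subset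
    intro v hv
    simp only [Set.mem_setOf_eq] at hv
    have h1 := hv.2
    have h2 : ((⌈hiI c₁' α⌉ : ℤ) : ℝ) ≥ hiI c₁' α := Int.le_ceil _
    constructor
    · have : -(v : ℝ) ≤ hiI c₁' α := (neg_le_abs _).trans h1
      have : (-(⌈hiI c₁' α⌉ : ℤ) : ℝ) ≤ v := by push_cast; linarith
      exact_mod_cast this
    · have : (v : ℝ) ≤ hiI c₁' α := (le_abs_self _).trans h1
      have : (v : ℝ) ≤ ((⌈hiI c₁' α⌉ : ℤ) : ℝ) := by linarith
      exact_mod_cast this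
  · exact Set.finite_singleton 0

def Box (c₁ c₁' ε : ℝ) : Set (Idx → ℤ) := Set.pi Set.univ (boxSet c₁ c₁' ε)

theorem isCompact_Box (c₁ c₁' ε : ℝ) : IsCompact (Box c₁ c₁' ε) :=
  isCompact_univ_pi fun α => (boxSet_finite c₁ c₁' ε α).isCompact

theorem windowed_curry7_of_mem_Box {c₁ c₁' ε : ℝ} {T : Idx → ℤ} (hT : T ∈ Box c₁ c₁' ε) :
    Windowed c₁ c₁' ε (curry7 T) := by
  intro p i j k r s z hp
  have h := hT (p, i, j, k, r, s, z) (Set.mem_univ _)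
  simp only [boxSet, hp, ↓reduceIte, Set.mem_setOf_eq, loI, hiI] at h
  exact h

/-- normalise a curried table to vanish off primes, then uncurry -/
noncomputable def normU (t : ℕ → ℕ → ℕ → ℕ → ℕ → ℕ → ℕ → ℤ) : Idx → ℤ :=
  fun α => if α.1.Prime then t α.1 α.2.1 α.2.2.1 α.2.2.2.1 α.2.2.2.2.1 α.2.2.2.2.2.1 α.2.2.2.2.2.2 else 0

theorem normU_mem_Box {c₁ c₁' ε : ℝ} {t : ℕ → ℕ → ℕ → ℕ → ℕ → ℕ → ℕ → ℤ} (ht : Windowed c₁ c₁' ε t) :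
    normU t ∈ Box c₁ c₁' ε := by
  intro α _
  obtain ⟨p, i, j, k, r, s, z⟩ := α
  by_cases hp : p.Prime
  · simp only [boxSet, hp, ↓reduceIte, Set.mem_setOf_eq, normU, loI, hiI]
    exact ht p i j k r s z hp
  · simp [boxSet, hp, normU]

theorem tameSumU_normU (t : ℕ → ℕ → ℕ → ℕ → ℕ → ℕ → ℕ → ℤ) (a b c : ℕ) :
    tameSumU (normU t) a b c = tameSum t a b c := by
  unfold tameSumU tameSum
  apply Finset.sum_congr rfl
  intro p hp
  have hpp : p.Prime := Nat.prime_of_mem_primeFactors hp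
  simp [normU, atom, hpp]

/-! ### the closed sets `Z N` -/

def Good (κ c₃ : ℝ) (N : ℕ) (T : Idx → ℤ) : Prop :=
  ∀ a b c : ℕ, IsABCTriple a b c → κ * (c : ℝ) ≤ (a : ℝ) → κ * (c : ℝ) ≤ (b : ℝ) → c ≤ N →
    |(tameSumU T a b c : ℝ)| ≤ c₃

def Z (κ c₁ c₁' c₃ ε : ℝ) (N : ℕ) : Set (Idx → ℤ) := Box c₁ c₁' ε ∩ {T | Good κ c₃ N T}

theorem continuous_tameSumU (a b c : ℕ) : Continuous fun T : Idx → ℤ => tameSumU T a b c := by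
  unfold tameSumU
  exact continuous_finsetSum _ fun p _ => continuous_apply _

theorem isClosed_good (κ c₃ : ℝ) (N : ℕ) : IsClosed {T : Idx → ℤ | Good κ c₃ N T} := by
  have : {T : Idx → ℤ | Good κ c₃ N T} =
      ⋂ a : ℕ, ⋂ b : ℕ, ⋂ c : ℕ, ⋂ (_ : IsABCTriple a b c), ⋂ (_ : κ * (c : ℝ) ≤ (a : ℝ)),
        ⋂ (_ : κ * (c : ℝ) ≤ (b : ℝ)), ⋂ (_ : c ≤ N),
          (fun T : Idx → ℤ => tameSumU T a b c) ⁻¹' {v : ℤ | |(v : ℝ)| ≤ c₃} := by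
    ext T
    simp [Good]
  rw [this]
  refine isClosed_iInter fun a => isClosed_iInter fun b => isClosed_iInter fun c =>
    isClosed_iInter fun _ => isClosed_iInter fun _ => isClosed_iInter fun _ => isClosed_iInter fun _ => ?_
  exact (isClosed_discrete _).preimage (continuous_tameSumU a b c)

theorem isClosed_Z (κ c₁ c₁' c₃ ε : ℝ) (N : ℕ) : IsClosed (Z κ c₁ c₁' c₃ ε N) :=
  (isCompact_Box c₁ c₁' ε).isClosed.inter (isClosed_good κ c₃ N)

theorem Z_antitone (κ c₁ c₁' c₃ ε : ℝ) (N : ℕ) : Z κ c₁ c₁' c₃ ε (N + 1) ⊆ Z κ c₁ c₁' c₃ ε N := by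
  rintro T ⟨hB, hG⟩
  exact ⟨hB, fun a b c h ha hb hc => hG a b c h ha hb (Nat.le_succ_of_le hc)⟩

/-! ### a crude uniform bound on tame sums of windowed tables in a box -/

theorem abs_tameSum_le {c₁ c₁' ε : ℝ} {t : ℕ → ℕ → ℕ → ℕ → ℕ → ℕ → ℕ → ℤ} (ht : Windowed c₁ c₁' ε t)
    (hc : 0 ≤ c₁') {a b c N : ℕ} (ha : 0 < a) (hb : 0 < b) (hc0 : 0 < c) (haN : a ≤ N) (hbN : b ≤ N)
    (hcN : c ≤ N) :
    |(tameSum t a b c : ℝ)| ≤ c₁' * ((3 * N + 1 : ℕ) : ℝ) * ((N ^ 3 : ℕ) : ℝ) * ((N ^ 3 + 1 : ℕ) : ℝ) := by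
  unfold tameSum
  push_cast [Int.cast_sum]
  have habc0 : a * b * c ≠ 0 := by positivity
  have habcN : a * b * c ≤ N ^ 3 := by
    calc a * b * c ≤ N * N * N := by gcongr
      _ = N ^ 3 := by ring
  -- each term bounded by c₁' (3N+1) N^3
  have hterm : ∀ p ∈ (a * b * c).primeFactors,
      |(t p (a.factorization p) (b.factorization p) (c.factorization p) (a / p ^ a.factorization p % p)
        (b / p ^ b.factorization p % p) (c / p ^ c.factorization p % p) : ℝ)|
        ≤ c₁' * ((3 * N + 1 : ℕ) : ℝ) * ((N ^ 3 : ℕ) : ℝ) := by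
    intro p hp
    have hpp : p.Prime := Nat.prime_of_mem_primeFactors hp
    have hpabc : p ≤ a * b * c := Nat.le_of_mem_primeFactors hp
    have hw := (ht p (a.factorization p) (b.factorization p) (c.factorization p)
      (a / p ^ a.factorization p % p) (b / p ^ b.factorization p % p) (c / p ^ c.factorization p % p) hpp).2
    have hK : a.factorization p + b.factorization p + c.factorization p ≤ 3 * N := by
      have h1 := Nat.factorization_lt p ha.ne'
      have h2 := Nat.factorization_lt p hb.ne'
      have h3 := Nat.factorization_lt p hc0.ne'
      omega
    have hK' : (((a.factorization p + b.factorization p + c.factorization p : ℕ) : ℝ) + 1)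
        ≤ ((3 * N + 1 : ℕ) : ℝ) := by
      push_cast
      exact_mod_cast (by omega : a.factorization p + b.factorization p + c.factorization p + 1 ≤ 3 * N + 1)
    have hp0 : (0 : ℝ) < p := by exact_mod_cast hpp.pos
    have hlogp : Real.log p ≤ ((N ^ 3 : ℕ) : ℝ) := by
      have h1 : Real.log p ≤ (p : ℝ) - 1 := Real.log_le_sub_one_of_pos hp0
      have h2 : (p : ℝ) ≤ ((N ^ 3 : ℕ) : ℝ) := by exact_mod_cast hpabc.trans habcN
      linarith
    have hlog0 : 0 ≤ Real.log p := Real.log_nonneg (by exact_mod_cast hpp.one_le)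
    calc _ ≤ c₁' * (((a.factorization p + b.factorization p + c.factorization p : ℕ) : ℝ) + 1) * Real.log p := hw
      _ ≤ c₁' * ((3 * N + 1 : ℕ) : ℝ) * Real.log p := by gcongr
      _ ≤ c₁' * ((3 * N + 1 : ℕ) : ℝ) * ((N ^ 3 : ℕ) : ℝ) := by gcongr
  have hcard : ((a * b * c).primeFactors.card : ℝ) ≤ ((N ^ 3 + 1 : ℕ) : ℝ) := by
    have h1 : (a * b * c).primeFactors ⊆ Finset.range (a * b * c + 1) := by
      intro p hp
      exact Finset.mem_range.mpr (Nat.lt_succ_of_le (Nat.le_of_mem_primeFactors hp))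
    have h2 := Finset.card_le_card h1
    rw [Finset.card_range] at h2
    exact_mod_cast h2.trans (by omega)
  calc |∑ p ∈ (a * b * c).primeFactors, (t p (a.factorization p) (b.factorization p) (c.factorization p)
          (a / p ^ a.factorization p % p) (b / p ^ b.factorization p % p) (c / p ^ c.factorization p % p) : ℝ)|
      ≤ ∑ p ∈ (a * b * c).primeFactors, |(t p (a.factorization p) (b.factorization p) (c.factorization p)
          (a / p ^ a.factorization p % p) (b / p ^ b.factorization p % p) (c / p ^ c.factorization p % p) : ℝ)| :=
        Finset.abs_sum_le_sum_abs _ _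
    _ ≤ ∑ _p ∈ (a * b * c).primeFactors, c₁' * ((3 * N + 1 : ℕ) : ℝ) * ((N ^ 3 : ℕ) : ℝ) :=
        Finset.sum_le_sum hterm
    _ = ((a * b * c).primeFactors.card : ℝ) * (c₁' * ((3 * N + 1 : ℕ) : ℝ) * ((N ^ 3 : ℕ) : ℝ)) := by
        rw [Finset.sum_const, nsmul_eq_mul]
    _ ≤ ((N ^ 3 + 1 : ℕ) : ℝ) * (c₁' * ((3 * N + 1 : ℕ) : ℝ) * ((N ^ 3 : ℕ) : ℝ)) := by
        gcongr
    _ = _ := by push_cast; ring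

/-! ### nonemptiness of `Z N` from the crux -/

theorem Z_nonempty {κ ε c₁ c₁' c₃ : ℝ} {m₀ : ℕ}
    (H : ∀ ℓ n : ℕ, ℓ.Prime → 5 ≤ ℓ → m₀ ≤ ℓ ^ n →
      ∃ t : ℕ → ℕ → ℕ → ℕ → ℕ → ℕ → ℕ → ℤ, Windowed c₁ c₁' ε t ∧
        ∀ a b c : ℕ, IsABCTriple a b c → κ * (c : ℝ) ≤ (a : ℝ) → κ * (c : ℝ) ≤ (b : ℝ) →
          ¬ ℓ ∣ a * b * c → ∃ B : ℤ, |(B : ℝ)| ≤ c₃ ∧ tameSum t a b c ≡ B [ZMOD ((ℓ ^ n : ℕ) : ℤ)])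
    (N : ℕ) : (Z κ c₁ c₁' c₃ ε N).Nonempty := by
  -- a prime above N^3 and 5
  obtain ⟨ℓ, hℓge, hℓ⟩ := Nat.exists_infinite_primes (N ^ 3 + 5)
  have h5 : 5 ≤ ℓ := by omega
  have hℓ1 : 1 < ℓ := by omega
  -- the modulus exponent
  set Y : ℝ := |c₁'| * ((3 * N + 1 : ℕ) : ℝ) * ((N ^ 3 : ℕ) : ℝ) * ((N ^ 3 + 1 : ℕ) : ℝ) with hY
  set n : ℕ := max m₀ (⌈Y + |c₃|⌉₊ + 1) with hn
  have hm₀ : m₀ ≤ ℓ ^ n := le_trans (le_max_left _ _) (Nat.lt_pow_self hℓ1).le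
  obtain ⟨t, ht, hcong⟩ := H ℓ n hℓ h5 hm₀
  refine ⟨normU t, normU_mem_Box ht, ?_⟩
  intro a b c habc ha hb hcN
  obtain ⟨ha0, hb0, hsum, hcop⟩ := habc
  have hc0 : 0 < c := by omega
  have haN : a ≤ N := by omega
  have hbN : b ≤ N := by omega
  -- ℓ ∤ abc
  have habcpos : 0 < a * b * c := by positivity
  have habcN : a * b * c ≤ N ^ 3 := by
    calc a * b * c ≤ N * N * N := by gcongr
      _ = N ^ 3 := by ring
  have hndvd : ¬ ℓ ∣ a * b * c := by
    intro hd
    have := Nat.le_of_dvd habcpos hd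
    omega
  obtain ⟨B, hB, hmod⟩ := hcong a b c ⟨ha0, hb0, hsum, hcop⟩ ha hb hndvd
  rw [tameSumU_normU]
  -- windows are satisfiable only if 0 ≤ c₁' (use the prime ℓ itself)
  have hc₁' : 0 ≤ c₁' := by
    have hw := (ht ℓ 0 0 0 0 0 0 hℓ).2
    have hlog : 0 < Real.log ℓ := Real.log_pos (by exact_mod_cast hℓ1)
    have h0 : 0 ≤ c₁' * ((((0 + 0 + 0 : ℕ) : ℝ)) + 1) * Real.log ℓ := (abs_nonneg _).trans hw
    simp at h0
    nlinarith
  have hbound : |(tameSum t a b c : ℝ)| ≤ Y := by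
    have h1 := abs_tameSum_le ht hc₁' ha0 hb0 hc0 haN hbN hcN
    rw [hY, abs_of_nonneg hc₁']
    exact h1
  -- congruence + smallness ⇒ equality
  have hdvd : ((ℓ ^ n : ℕ) : ℤ) ∣ B - tameSum t a b c := (Int.modEq_iff_dvd.mp hmod)
  have hlt : |B - tameSum t a b c| < ((ℓ ^ n : ℕ) : ℤ) := by
    have h1 : |(B : ℝ) - (tameSum t a b c : ℝ)| ≤ |(B : ℝ)| + |(tameSum t a b c : ℝ)| := abs_sub _ _
    have h2 : |(B : ℝ)| ≤ |c₃| := hB.trans (le_abs_self _)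
    have h3 : (Y + |c₃| : ℝ) < n := by
      have h8 : ⌈Y + |c₃|⌉₊ + 1 ≤ n := le_max_right _ _
      have h9 : ((⌈Y + |c₃|⌉₊ + 1 : ℕ) : ℝ) ≤ (n : ℝ) := by exact_mod_cast h8
      have h10 := Nat.le_ceil (Y + |c₃|)
      push_cast at h9
      linarith
    have h4 : (n : ℝ) < ((ℓ ^ n : ℕ) : ℝ) := by exact_mod_cast Nat.lt_pow_self hℓ1
    have h6 : |(B : ℝ) - (tameSum t a b c : ℝ)| < ((ℓ ^ n : ℕ) : ℝ) := by linarith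
    have h7 : ((|B - tameSum t a b c| : ℤ) : ℝ) < ((ℓ ^ n : ℕ) : ℝ) := by
      rw [Int.cast_abs, Int.cast_sub]; exact h6
    exact_mod_cast h7
  have heq : B - tameSum t a b c = 0 := Int.eq_zero_of_abs_lt_dvd hdvd hlt
  have : tameSum t a b c = B := by linarith
  rw [this]
  exact hB

/-! ### the theorem -/

theorem tlrInfty_of_tlr :
    Summit.ABC.ABC.Theses.CongruentialReceptacle.TameLocalReceptacle → TLRInfty := by
  intro hT κ hκ ε hε
  obtain ⟨c₁, c₁', c₃, hc₁, m₀, H⟩ := hT κ hκ ε hε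
  have hne := fun N => Z_nonempty (κ := κ) (ε := ε) (c₁ := c₁) (c₁' := c₁') (c₃ := c₃) (m₀ := m₀) H N
  have hI : (⋂ N, Z κ c₁ c₁' c₃ ε N).Nonempty :=
    IsCompact.nonempty_iInter_of_sequence_nonempty_isCompact_isClosed _ (Z_antitone κ c₁ c₁' c₃ ε) hne
      ((isCompact_Box c₁ c₁' ε).of_isClosed_subset (isClosed_Z κ c₁ c₁' c₃ ε 0) Set.inter_subset_left)
      (isClosed_Z κ c₁ c₁' c₃ ε)
  obtain ⟨T, hTmem⟩ := hI
  rw [Set.mem_iInter] at hTmem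
  refine ⟨c₁, c₁', c₃, hc₁, curry7 T, windowed_curry7_of_mem_Box (hTmem 0).1, ?_⟩
  intro a b c habc ha hb
  rw [tameSum_curry7]
  exact (hTmem c).2 a b c habc ha hb le_rfl


/-- **TLR ⟺ TLR∞**: the modulus `ℓⁿ` and the side condition `ℓ ∤ abc` carry no content. -/
theorem tlr_iff_tlrInfty :
    Summit.ABC.ABC.Theses.CongruentialReceptacle.TameLocalReceptacle ↔ TLRInfty :=
  ⟨tlrInfty_of_tlr, tlr_of_tlrInfty⟩

/-! ### Card `apical-cancellation` -/

/-- One-position ("member") table `u p i r`: entry at a prime `p` with `p^i ∥ x`, `r = (x/p^i) mod p`. -/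
def MemberWindowed (c₁ c₁' ε : ℝ) (u : ℕ → ℕ → ℕ → ℤ) : Prop :=
  ∀ p i r : ℕ, p.Prime → 1 ≤ i →
    c₁ * (2 * (i : ℝ) - 6 - ε) * Real.log p ≤ (u p i r : ℝ) ∧
      |(u p i r : ℝ)| ≤ c₁' * ((i : ℝ) + 1) * Real.log p

/-- The APEX RECURSION: at a simple prime `p` the entry reads the residue `R < p` as the exact
cofactor and cancels every entry that cofactor would carry (`(p·R/q^j) mod q` is the datum of
`x = p·R` at `q`). Well-founded: all `q ∣ R` are `< p`. -/
def ApexRecursion (u : ℕ → ℕ → ℕ → ℤ) : Prop :=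
  ∀ p R : ℕ, p.Prime → 0 < R → R < p →
    u p 1 R = -∑ q ∈ R.primeFactors, u q (R.factorization q) (p * R / q ^ R.factorization q % q)

/-- The member sum `Σ_{p ∣ x} u(p; v_p x; (x/p^{v_p x}) mod p)`. -/
noncomputable def memberSum (u : ℕ → ℕ → ℕ → ℤ) (x : ℕ) : ℤ :=
  ∑ p ∈ x.primeFactors, u p (x.factorization p) (x / p ^ x.factorization p % p)

/-- `x` is APICAL if some prime divides it exactly once and exceeds its cofactor
(`P ∥ x`, `x < P²`); about `log 2` of all integers. -/
def Apical (x : ℕ) : Prop := ∃ P : ℕ, P.Prime ∧ P ∣ x ∧ ¬ P ^ 2 ∣ x ∧ x < P ^ 2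

/-- FIRST LEMMA of the card (exact internal cancellation): under the apex recursion the member
sum of every apical `x` vanishes identically — whatever the lower entries are (forced or misfired),
the apex entry recomputes and cancels them. Elementary (`Finset.sum` bookkeeping). -/
theorem memberSum_eq_zero_of_apical (u : ℕ → ℕ → ℕ → ℤ) (hu : ApexRecursion u)
    (x : ℕ) (hx : Apical x) : memberSum u x = 0 := by
  obtain ⟨P, hP, hPx, hP2, hxP⟩ := hx
  have hx0 : x ≠ 0 := by rintro rfl; exact hP2 (dvd_zero _)
  obtain ⟨R, rfl⟩ := hPx
  have hP0 : P ≠ 0 := hP.ne_zero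
  have hR0 : R ≠ 0 := by rintro rfl; simp at hx0
  have hRP : R < P := by
    have h : P * R < P * P := by simpa [sq] using hxP
    exact Nat.lt_of_mul_lt_mul_left h
  have hPR : ¬ P ∣ R := by
    intro h; apply hP2; obtain ⟨S, rfl⟩ := h; exact ⟨S, by ring⟩
  have hfacP : (P * R).factorization P = 1 := by
    rw [Nat.factorization_mul hP0 hR0]
    simp [hP.factorization, Nat.factorization_eq_zero_of_not_dvd hPR]
  have hfacq : ∀ q ∈ R.primeFactors, (P * R).factorization q = R.factorization q := by
    intro q hq
    have hqP : q ≠ P := by rintro rfl; exact hPR (Nat.dvd_of_mem_primeFactors hq)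
    rw [Nat.factorization_mul hP0 hR0]
    simp [hP.factorization, Finsupp.single_apply, hqP, hqP.symm]
  have hpf : (P * R).primeFactors = insert P R.primeFactors := by
    rw [Nat.primeFactors_mul hP0 hR0, hP.primeFactors, ← Finset.insert_eq]
  have hPnot : P ∉ R.primeFactors := fun h => hPR (Nat.dvd_of_mem_primeFactors h)
  have h1 : P * R / P ^ 1 % P = R := by
    rw [pow_one, Nat.mul_div_cancel_left R hP.pos, Nat.mod_eq_of_lt hRP]
  have h2 : ∑ q ∈ R.primeFactors, u q ((P * R).factorization q) (P * R / q ^ (P * R).factorization q % q)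
      = ∑ q ∈ R.primeFactors, u q (R.factorization q) (P * R / q ^ R.factorization q % q) :=
    Finset.sum_congr rfl (fun q hq => by rw [hfacq q hq])
  unfold memberSum
  rw [hpf, Finset.sum_insert hPnot, hfacP, h1, hu P R hP (Nat.pos_of_ne_zero hR0) hRP, h2]
  ring

/-! #### The apex table, constructed (well-founded recursion on `p`) and its window closure, kernel-checked -/

/-- The apex table: forced entries `⌈c₁(2i−6−ε) log p⌉₊` at `i ≥ 2`; at `i = 1` the entry reads the
residue `R < p` as the cofactor and cancels everything the cofactor carries; `0` elsewhere. -/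
noncomputable def apexU (c₁ ε : ℝ) (p i R : ℕ) : ℤ :=
  if 2 ≤ i then ((⌈c₁ * (2 * (i : ℝ) - 6 - ε) * Real.log p⌉₊ : ℕ) : ℤ)
  else if h : i = 1 ∧ 0 < R ∧ R < p then
    -∑ q ∈ R.primeFactors.attach,
      apexU c₁ ε q.1 (R.factorization q.1) (p * R / q.1 ^ R.factorization q.1 % q.1)
  else 0
termination_by p
decreasing_by
  have hq := Nat.le_of_mem_primeFactors q.2
  omega

theorem apexU_of_two_le (c₁ ε : ℝ) (p i R : ℕ) (hi : 2 ≤ i) :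
    apexU c₁ ε p i R = ((⌈c₁ * (2 * (i : ℝ) - 6 - ε) * Real.log p⌉₊ : ℕ) : ℤ) := by
  rw [apexU]; simp [hi]

theorem apexU_one (c₁ ε : ℝ) (p R : ℕ) (hR : 0 < R) (hRp : R < p) :
    apexU c₁ ε p 1 R =
      -∑ q ∈ R.primeFactors, apexU c₁ ε q (R.factorization q) (p * R / q ^ R.factorization q % q) := by
  rw [apexU]
  simp only [Nat.not_ofNat_le_one, ↓reduceIte, hR, hRp, and_self, ↓reduceDIte, neg_inj]
  exact Finset.sum_attach R.primeFactors
    (fun q => apexU c₁ ε q (R.factorization q) (p * R / q ^ R.factorization q % q))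

theorem apexU_one_of_not (c₁ ε : ℝ) (p R : ℕ) (h : ¬ (0 < R ∧ R < p)) :
    apexU c₁ ε p 1 R = 0 := by
  rw [apexU]
  simp only [Nat.not_ofNat_le_one, ↓reduceIte, true_and]
  rw [dif_neg h]

theorem apexU_zero (c₁ ε : ℝ) (p R : ℕ) : apexU c₁ ε p 0 R = 0 := by
  rw [apexU]; simp

/-- Forced entries are small: `⌈c₁(2j−6−ε) log q⌉₊ ≤ 2 c₁ j log q` for primes `q`, `j ≥ 2`, `c₁ ≥ 1`. -/
theorem ceil_forced_le (c₁ ε : ℝ) (hc₁ : 1 ≤ c₁) (hε : 0 < ε) (q j : ℕ) (hq : q.Prime) (hj : 2 ≤ j) :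
    ((⌈c₁ * (2 * (j : ℝ) - 6 - ε) * Real.log q⌉₊ : ℕ) : ℝ) ≤ 2 * c₁ * ((j : ℝ) * Real.log q) := by
  have hq2 : (2 : ℝ) ≤ q := by exact_mod_cast hq.two_le
  have hlog2 : (0.6931471803 : ℝ) < Real.log 2 := Real.log_two_gt_d9
  have hlogq : Real.log 2 ≤ Real.log q := Real.log_le_log (by norm_num) hq2
  have hlogpos : 0 < Real.log q := by linarith
  have hjR : (2 : ℝ) ≤ j := by exact_mod_cast hj
  set y := c₁ * (2 * (j : ℝ) - 6 - ε) * Real.log q with hy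
  by_cases hy0 : y ≤ 0
  · rw [Nat.ceil_eq_zero.mpr hy0]
    simp only [Nat.cast_zero]
    positivity
  · push_neg at hy0
    have h1 : ((⌈y⌉₊ : ℕ) : ℝ) < y + 1 := Nat.ceil_lt_add_one hy0.le
    have h2 : y + 1 ≤ 2 * c₁ * ((j : ℝ) * Real.log q) := by
      rw [hy]
      have h3 : c₁ * (2 * (j : ℝ) - 6 - ε) * Real.log q ≤ c₁ * (2 * (j : ℝ) - 6) * Real.log q := by
        have : 0 ≤ c₁ * ε * Real.log q := by positivity
        nlinarith
      have h4 : 1 ≤ 6 * c₁ * Real.log q := by nlinarith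
      nlinarith
    linarith

/-- `log n = ∑_{p ∣ n} ν_p(n) · log p` for `n ≠ 0` (same proof as the tree's
`Literature.Barriers.ABC.log_eq_sum_factorization_mul_log`, inlined to keep imports minimal). -/
theorem log_eq_sum_factorization_mul_log' {n : ℕ} (hn : n ≠ 0) :
    Real.log n = ∑ p ∈ n.primeFactors, (n.factorization p : ℝ) * Real.log p := by
  conv_lhs => rw [Nat.prod_primeFactors_pow_factorization hn]
  push_cast
  rw [Real.log_prod]
  · exact Finset.sum_congr rfl fun p _ => by rw [Real.log_pow]
  · intro p hp
    exact pow_ne_zero _ (by exact_mod_cast (Nat.prime_of_mem_primeFactors hp).ne_zero)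

/-- LOG-DISJOINTNESS INDUCTION: `|apexU p 1 R| ≤ 2 c₁ log R` whenever `0 < R < p`. -/
theorem apexU_abs_le (c₁ ε : ℝ) (hc₁ : 1 ≤ c₁) (hε : 0 < ε) :
    ∀ p R : ℕ, 0 < R → R < p → |(apexU c₁ ε p 1 R : ℝ)| ≤ 2 * c₁ * Real.log R := by
  intro p
  induction p using Nat.strong_induction_on with
  | _ p ih =>
    intro R hR hRp
    rw [apexU_one c₁ ε p R hR hRp]
    push_cast
    rw [abs_neg]
    have hc₀ : 0 ≤ c₁ := by linarith
    calc |∑ q ∈ R.primeFactors, (apexU c₁ ε q (R.factorization q) (p * R / q ^ R.factorization q % q) : ℝ)|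
        ≤ ∑ q ∈ R.primeFactors, |(apexU c₁ ε q (R.factorization q) (p * R / q ^ R.factorization q % q) : ℝ)| :=
          Finset.abs_sum_le_sum_abs _ _
      _ ≤ ∑ q ∈ R.primeFactors, 2 * c₁ * ((R.factorization q : ℝ) * Real.log q) := by
          apply Finset.sum_le_sum
          intro q hq
          have hqprime : q.Prime := Nat.prime_of_mem_primeFactors hq
          have hqR : q ≤ R := Nat.le_of_mem_primeFactors hq
          have hqp : q < p := lt_of_le_of_lt hqR hRp
          have hq2 : (2 : ℝ) ≤ q := by exact_mod_cast hqprime.two_le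
          have hlogq : 0 ≤ Real.log q := Real.log_nonneg (by linarith)
          have hj1 : 1 ≤ R.factorization q := by
            have := (Nat.mem_primeFactors.mp hq)
            exact Nat.Prime.factorization_pos_of_dvd hqprime hR.ne' this.2.1
          rcases Nat.lt_or_ge (R.factorization q) 2 with hlt | hge
          · -- j = 1 : recursive entry, bounded by induction (or zero)
            have hj : R.factorization q = 1 := by omega
            rw [hj]
            simp only [pow_one, Nat.cast_one, one_mul]
            set r' := p * R / q % q with hr'
            by_cases hr0 : 0 < r'
            · have hr'q : r' < q := Nat.mod_lt _ hqprime.pos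
              have hih := ih q hqp r' hr0 hr'q
              have hlogr : Real.log r' ≤ Real.log q :=
                Real.log_le_log (by exact_mod_cast hr0) (by exact_mod_cast hr'q.le)
              calc |(apexU c₁ ε q 1 r' : ℝ)| ≤ 2 * c₁ * Real.log r' := hih
                _ ≤ 2 * c₁ * Real.log q := by nlinarith
            · have : ¬ (0 < r' ∧ r' < q) := fun h => hr0 h.1
              rw [apexU_one_of_not c₁ ε q r' this]
              simp only [Int.cast_zero, abs_zero]
              positivity
          · -- j ≥ 2 : forced entry
            rw [apexU_of_two_le c₁ ε q _ _ hge]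
            push_cast
            rw [abs_of_nonneg (by positivity)]
            exact_mod_cast ceil_forced_le c₁ ε hc₁ hε q (R.factorization q) hqprime hge
      _ = 2 * c₁ * ∑ q ∈ R.primeFactors, ((R.factorization q : ℝ) * Real.log q) := by
          rw [Finset.mul_sum]
      _ = 2 * c₁ * Real.log R := by
          rw [log_eq_sum_factorization_mul_log' hR.ne']

theorem apexU_recursion (c₁ ε : ℝ) : ApexRecursion (apexU c₁ ε) :=
  fun p R _ hR hRp => apexU_one c₁ ε p R hR hRp

theorem apexU_windowed (c₁ ε : ℝ) (hc₁ : 1 ≤ c₁) (hε : 0 < ε) :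
    MemberWindowed c₁ (2 * c₁) ε (apexU c₁ ε) := by
  intro p i r hp hi
  have hp2 : (2 : ℝ) ≤ p := by exact_mod_cast hp.two_le
  have hlog2 : (0.6931471803 : ℝ) < Real.log 2 := Real.log_two_gt_d9
  have hlogp : Real.log 2 ≤ Real.log p := Real.log_le_log (by norm_num) hp2
  have hlogpos : 0 < Real.log p := by linarith
  have hc₀ : 0 < c₁ := by linarith
  have h0 : 0 ≤ c₁ * Real.log p := by positivity
  have h3 : 0 ≤ c₁ * ε * Real.log p := by positivity
  rcases Nat.lt_or_ge i 2 with hlt | hge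
  · have hi1 : i = 1 := by omega
    subst hi1
    simp only [Nat.cast_one]
    by_cases h : 0 < r ∧ r < p
    · have hb := apexU_abs_le c₁ ε hc₁ hε p r h.1 h.2
      have hlogr : Real.log r ≤ Real.log p :=
        Real.log_le_log (by exact_mod_cast h.1) (by exact_mod_cast h.2.le)
      have h4 : 2 * c₁ * Real.log r ≤ 2 * c₁ * Real.log p :=
        mul_le_mul_of_nonneg_left hlogr (by positivity)
      have hb' := hb.trans h4
      have h5 := neg_abs_le (apexU c₁ ε p 1 r : ℝ)
      constructor
      · linarith
      · linarith
    · rw [apexU_one_of_not c₁ ε p r h]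
      simp only [Int.cast_zero, abs_zero]
      constructor
      · linarith
      · linarith
  · rw [apexU_of_two_le c₁ ε p i r hge]
    push_cast
    constructor
    · exact Nat.le_ceil _
    · rw [abs_of_nonneg (by positivity)]
      have h1 := ceil_forced_le c₁ ε hc₁ hε p i hp hge
      linarith

theorem exists_apexTable (c₁ ε : ℝ) (hc₁ : 1 ≤ c₁) (hε : 0 < ε) :
    ∃ u : ℕ → ℕ → ℕ → ℤ, ApexRecursion u ∧ MemberWindowed c₁ (2 * c₁) ε u ∧
      ∀ p i r : ℕ, 2 ≤ i → u p i r = ⌈c₁ * (2 * (i : ℝ) - 6 - ε) * Real.log p⌉₊ :=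
  ⟨apexU c₁ ε, apexU_recursion c₁ ε, apexU_windowed c₁ ε hc₁ hε,
    fun p i r hi => apexU_of_two_le c₁ ε p i r hi⟩


/-- The position-symmetric 7-argument table built from `apexU`; mixed (non-occurring) data get the
forced ceiling so that the windows hold everywhere. -/
noncomputable def apexT (c₁ ε : ℝ) (p i j k r s z : ℕ) : ℤ :=
  if 1 ≤ i ∧ j = 0 ∧ k = 0 then apexU c₁ ε p i r
  else if i = 0 ∧ 1 ≤ j ∧ k = 0 then apexU c₁ ε p j s
  else if i = 0 ∧ j = 0 ∧ 1 ≤ k then apexU c₁ ε p k z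
  else ((⌈c₁ * (2 * ((i + j + k : ℕ) : ℝ) - 6 - ε) * Real.log p⌉₊ : ℕ) : ℤ)

theorem apexT_a (c₁ ε : ℝ) (p i r s z : ℕ) (hi : 1 ≤ i) : apexT c₁ ε p i 0 0 r s z = apexU c₁ ε p i r := by
  unfold apexT; simp [hi]

theorem apexT_b (c₁ ε : ℝ) (p j r s z : ℕ) (hj : 1 ≤ j) : apexT c₁ ε p 0 j 0 r s z = apexU c₁ ε p j s := by
  unfold apexT; simp [hj]

theorem apexT_c (c₁ ε : ℝ) (p k r s z : ℕ) (hk : 1 ≤ k) : apexT c₁ ε p 0 0 k r s z = apexU c₁ ε p k z := by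
  unfold apexT; simp [hk]

theorem ceil_window_le (c₁ ε : ℝ) (hc₁ : 1 ≤ c₁) (hε : 0 < ε) (p K : ℕ) (hp : p.Prime) :
    ((⌈c₁ * (2 * (K : ℝ) - 6 - ε) * Real.log p⌉₊ : ℕ) : ℝ) ≤ 2 * c₁ * ((K : ℝ) + 1) * Real.log p := by
  have hp2 : (2 : ℝ) ≤ p := by exact_mod_cast hp.two_le
  have hlogp : 0 < Real.log p := Real.log_pos (by linarith)
  have hc₀ : 0 < c₁ := by linarith
  have h0 : 0 ≤ c₁ * Real.log p := by positivity
  rcases Nat.lt_or_ge K 2 with hlt | hge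
  · have hK : (K : ℝ) ≤ 1 := by exact_mod_cast (by omega : K ≤ 1)
    have hy : c₁ * (2 * (K : ℝ) - 6 - ε) * Real.log p ≤ 0 := by
      have h5 : 2 * (K : ℝ) - 6 - ε ≤ 0 := by linarith
      have h6 : c₁ * (2 * (K : ℝ) - 6 - ε) ≤ 0 := by nlinarith
      nlinarith
    rw [Nat.ceil_eq_zero.mpr hy]
    simp only [Nat.cast_zero]
    have hK0 : (0 : ℝ) ≤ K := Nat.cast_nonneg K
    nlinarith
  · have h1 := ceil_forced_le c₁ ε hc₁ hε p K hp hge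
    nlinarith [h1, h0]

theorem apexT_windowed (c₁ ε : ℝ) (hc₁ : 1 ≤ c₁) (hε : 0 < ε) :
    Windowed c₁ (2 * c₁) ε (apexT c₁ ε) := by
  intro p i j k r s z hp
  have hW := apexU_windowed c₁ ε hc₁ hε
  unfold apexT
  split_ifs with h1 h2 h3
  · obtain ⟨hi, rfl, rfl⟩ := h1
    simpa using hW p i r hp hi
  · obtain ⟨rfl, hj, rfl⟩ := h2
    simpa using hW p j s hp hj
  · obtain ⟨rfl, rfl, hk⟩ := h3
    simpa using hW p k z hp hk
  · simp only [Int.cast_natCast]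
    refine ⟨Nat.le_ceil _, ?_⟩
    rw [abs_of_nonneg (by positivity)]
    exact ceil_window_le c₁ ε hc₁ hε p (i + j + k) hp

/-- no prime of one member divides a coprime partner -/
theorem not_dvd_of_coprime_of_dvd {p m n : ℕ} (hp : p.Prime) (h : Nat.Coprime m n) (hm : p ∣ m) :
    ¬ p ∣ n := by
  intro hn
  have h1 : p ∣ Nat.gcd m n := Nat.dvd_gcd hm hn
  rw [Nat.Coprime.gcd_eq_one h] at h1
  exact hp.one_lt.ne' (Nat.dvd_one.mp h1)

/-- On an abc-triple the symmetric table splits into the three member sums. -/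
theorem tameSum_apexT (c₁ ε : ℝ) (a b c : ℕ) (h : IsABCTriple a b c) :
    tameSum (apexT c₁ ε) a b c =
      memberSum (apexU c₁ ε) a + memberSum (apexU c₁ ε) b + memberSum (apexU c₁ ε) c := by
  obtain ⟨ha, hb, hsum, hab⟩ := h
  have hc : 0 < c := by omega
  have hac : Nat.Coprime a c := by rw [← hsum]; exact Nat.coprime_self_add_right.mpr hab
  have hbc : Nat.Coprime b c := by rw [← hsum]; exact Nat.coprime_add_self_right.mpr hab.symm
  have hpf : (a * b * c).primeFactors = a.primeFactors ∪ b.primeFactors ∪ c.primeFactors := by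
    rw [Nat.primeFactors_mul (by positivity) hc.ne', Nat.primeFactors_mul ha.ne' hb.ne']
  have hdab : Disjoint a.primeFactors b.primeFactors := hab.disjoint_primeFactors
  have hdac : Disjoint a.primeFactors c.primeFactors := hac.disjoint_primeFactors
  have hdbc : Disjoint b.primeFactors c.primeFactors := hbc.disjoint_primeFactors
  have hd : Disjoint (a.primeFactors ∪ b.primeFactors) c.primeFactors :=
    Finset.disjoint_union_left.mpr ⟨hdac, hdbc⟩
  unfold tameSum memberSum
  rw [hpf, Finset.sum_union hd, Finset.sum_union hdab]
  refine congrArg₂ (· + ·) (congrArg₂ (· + ·) (Finset.sum_congr rfl fun p hp => ?_)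
    (Finset.sum_congr rfl fun p hp => ?_)) (Finset.sum_congr rfl fun p hp => ?_)
  · have hpp := Nat.prime_of_mem_primeFactors hp
    have hpa := Nat.dvd_of_mem_primeFactors hp
    have hb0 : b.factorization p = 0 :=
      Nat.factorization_eq_zero_of_not_dvd (not_dvd_of_coprime_of_dvd hpp hab hpa)
    have hc0 : c.factorization p = 0 :=
      Nat.factorization_eq_zero_of_not_dvd (not_dvd_of_coprime_of_dvd hpp hac hpa)
    have ha1 : 1 ≤ a.factorization p := hpp.factorization_pos_of_dvd ha.ne' hpa
    rw [hb0, hc0, apexT_a c₁ ε p _ _ _ _ ha1]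
  · have hpp := Nat.prime_of_mem_primeFactors hp
    have hpb := Nat.dvd_of_mem_primeFactors hp
    have ha0 : a.factorization p = 0 :=
      Nat.factorization_eq_zero_of_not_dvd (not_dvd_of_coprime_of_dvd hpp hab.symm hpb)
    have hc0 : c.factorization p = 0 :=
      Nat.factorization_eq_zero_of_not_dvd (not_dvd_of_coprime_of_dvd hpp hbc hpb)
    have hb1 : 1 ≤ b.factorization p := hpp.factorization_pos_of_dvd hb.ne' hpb
    rw [ha0, hc0, apexT_b c₁ ε p _ _ _ _ hb1]
  · have hpp := Nat.prime_of_mem_primeFactors hp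
    have hpc := Nat.dvd_of_mem_primeFactors hp
    have ha0 : a.factorization p = 0 :=
      Nat.factorization_eq_zero_of_not_dvd (not_dvd_of_coprime_of_dvd hpp hac.symm hpc)
    have hb0 : b.factorization p = 0 :=
      Nat.factorization_eq_zero_of_not_dvd (not_dvd_of_coprime_of_dvd hpp hbc.symm hpc)
    have hc1 : 1 ≤ c.factorization p := hpp.factorization_pos_of_dvd hc.ne' hpc
    rw [ha0, hb0, apexT_c c₁ ε p _ _ _ _ hc1]

/-- What the lever delivers toward the crux (PROVED): a windowed (position-symmetric) table whose
tame sum is EXACTLY `0` on every abc-triple with three apical members (no balance needed,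
`c₃ = 0`, constants `c₁ = 1`, `c₁' = 2`).  The residual of TLR∞ is cross-member cancellation for
non-apical members (see the card). -/
theorem tameSum_eq_zero_of_apical (ε : ℝ) (hε : 0 < ε) :
    ∃ c₁ c₁' : ℝ, 0 < c₁ ∧ ∃ t : ℕ → ℕ → ℕ → ℕ → ℕ → ℕ → ℕ → ℤ, Windowed c₁ c₁' ε t ∧
      ∀ a b c : ℕ, IsABCTriple a b c → Apical a → Apical b → Apical c → tameSum t a b c = 0 := by
  refine ⟨1, 2 * 1, one_pos, apexT 1 ε, apexT_windowed 1 ε le_rfl hε, ?_⟩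
  intro a b c h hA hB hC
  rw [tameSum_apexT 1 ε a b c h, memberSum_eq_zero_of_apical _ (apexU_recursion 1 ε) a hA,
    memberSum_eq_zero_of_apical _ (apexU_recursion 1 ε) b hB,
    memberSum_eq_zero_of_apical _ (apexU_recursion 1 ε) c hC]
  simp

/-! ### Card `tame-cycle-duality` -/

/-- Lower and upper window of an atom at prime `p` with total multiplicity `K = i+j+k`. -/
noncomputable def loW (c₁ ε : ℝ) (p K : ℕ) : ℝ := c₁ * (2 * (K : ℝ) - 6 - ε) * Real.log p
noncomputable def hiW (c₁' : ℝ) (p K : ℕ) : ℝ := c₁' * ((K : ℝ) + 1) * Real.log p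

/-- Atom discrepancy of a finitely supported signed family `w` of triples at an atom `α`:
`d_α(w) = Σ_{T ∋ α} w T`. -/
noncomputable def atomDisc (w : ℕ × ℕ × ℕ → ℝ) (S : Finset (ℕ × ℕ × ℕ))
    (α : ℕ × ℕ × ℕ × ℕ × ℕ × ℕ × ℕ) : ℝ :=
  ∑ T ∈ S, if α.1 ∈ (T.1 * T.2.1 * T.2.2).primeFactors ∧ atom T.1 T.2.1 T.2.2 α.1 = α then w T else 0

/-- **DISCREPANCY INEQUALITY** (Farkas dual of TLR∞ restricted to a finite family, real relaxation):
for every finite signed family of κ-balanced triples, the window-weighted atom discrepancy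
`Σ_α (lo_α·d_α⁺ − hi_α·d_α⁻)` is at most `c₃·‖w‖₁`.  By LP duality + compactness,
`TLRInfty` (real-valued tables) ⟺ this; a refuting certificate is a pair of families with equal
odd-atom statistics and different forced 2-adic mass. -/
def DiscrepancyInequality : Prop :=
  ∀ κ : ℝ, 0 < κ → ∀ ε : ℝ, 0 < ε → ∃ c₁ c₁' c₃ : ℝ, 0 < c₁ ∧
    ∀ (S : Finset (ℕ × ℕ × ℕ)) (w : ℕ × ℕ × ℕ → ℝ),
      (∀ T ∈ S, IsABCTriple T.1 T.2.1 T.2.2 ∧ κ * (T.2.2 : ℝ) ≤ (T.1 : ℝ) ∧ κ * (T.2.2 : ℝ) ≤ (T.2.1 : ℝ)) →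
      ∀ (As : Finset (ℕ × ℕ × ℕ × ℕ × ℕ × ℕ × ℕ)),
        (∀ T ∈ S, ∀ p ∈ (T.1 * T.2.1 * T.2.2).primeFactors, atom T.1 T.2.1 T.2.2 p ∈ As) →
        ∑ α ∈ As, (loW c₁ ε α.1 (α.2.1 + α.2.2.1 + α.2.2.2.1) * max (atomDisc w S α) 0
            - hiW c₁' α.1 (α.2.1 + α.2.2.1 + α.2.2.2.1) * max (-(atomDisc w S α)) 0)
          ≤ c₃ * ∑ T ∈ S, |w T|

/-- Statement only: weak duality (the easy half, `TLRInfty →` this with real tables) is a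
three-line Abel summation; strong duality + compactness gives the converse for real-valued tables. -/
theorem discrepancy_of_tlrInfty : TLRInfty → DiscrepancyInequality := by
  sorry

end Summit.ABC.ABC.Cruxes.TameLocalReceptacle.Sketch
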